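import Literature.AlgebraicGeometry.Pohlmann1968.WeilTypeCMSubfieldRankBound
import Literature.AlgebraicGeometry.ComplexMultiplication.CyclotomicCMTypeResidueSets
import Literature.NumberTheory.ComplexMultiplication.CMTypeCount
import Mathlib.FieldTheory.Galois.Basic
import HarnessLib

/-!
# CM types of `ℚ(ζ_N)` balanced over the cosets of a subgroup of `(ℤ/N)ˣ`: Weil type over the fixed field, Yanai's
# degeneracy, and the Mumford–Pohlmann exceptional Hodge classes — READ ON RESIDUES

Layer `Literature/AlgebraicGeometry/Pohlmann1968`; companion of `WeilTypeCMSubfieldExceptionalClasses` (a CM type `Φ` of a CM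
field `K` BALANCED over a subfield `j : k → K` — over every embedding `τ` of `k` as many extensions in `Φ` as outside — is
DEGENERATE (Yanai), and every realisation of a PRIMITIVE such type carries exceptional Hodge classes in degree `[K : k]`
(Mumford–Pohlmann); its header lists «existence of … primitive balanced types on a concrete field … a `decide` census, not
attempted here» under NOT HERE), of `WeilTypeCMSubfieldRankBound` (`rank(Φ) + |T| ≤ n + 1`) and of seat p29's residue
dictionary `ComplexMultiplication/CyclotomicCMTypeResidueSets` (CM types of `L = ℚ(ζ_N)` ↔ residue sets `S ⊂ (ℤ/N)ˣ`,
`a(γ)`, `e(σ ∘ γ) = e(σ) a(γ)`).  Lane `lit-hodgefound`, prover seat `lit-hodgefound-p10`, generation 34, row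
«A3-(coset-balanced CM types)» (self-proposed 2026-08-28).  Everything is PROVED, THEOREMS ONLY (no definition, no named fact).

THE MECHANISM ON RESIDUES.  Let `W ⊆ (ℤ/N)ˣ` be closed under multiplication with `1 ∈ W` (a subgroup) and `−1 ∉ W`, and let
`H = {γ ∈ Gal(L/ℚ) | a(γ) ∈ W}` and `k = L^H` (a CM subfield: `−1 ∉ W`).  The embeddings of `L` extending a given embedding of
`k` form ONE `H`-orbit `{φ ∘ γ | γ ∈ H}`, i.e. on exponents ONE COSET `e(φ)·W` (Galois correspondence,
`IntermediateField.fixingSubgroup_fixedField`; `e(φ ∘ γ) = e(φ) a(γ)`).  Hence **`Φ` is balanced over `k` iff its residue set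
`S` meets every coset `cW` in exactly half: `#{w ∈ W | cw ∈ S} = #{w ∈ W | cw ∉ S}`** («COSET-BALANCED»), and then:

* `not_isNondegenerate_of_cosetBalanced` — **`Φ` is DEGENERATE** (Yanai, Gordon 9.4.3 Theorem [B.140], case `a = b`);
  `cmTypeRank_le_of_cosetBalanced` — `rank(Φ) ≤ φ(N)/2 = n` (index of degeneracy `≥ 1`); `cmTypeRank_add_le_of_cosetBalanced` —
  Yanai at full strength, `rank(Φ) + m ≤ n + 1` for `|W|·2m = φ(N)` (index of degeneracy `≥ [L^H : ℚ]/2`);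
* `exists_exceptional_of_cosetBalanced` — if moreover `Φ` is PRIMITIVE (`HasTrivialStabilizer`, Shimura §8.2 Prop. 26: its
  varieties are simple), **every realisation `(A, ι, θ)` of `(L; Φ)` carries a rational Hodge class of type `(m, m)`, `2m = |W|`,
  OUTSIDE `Dᵐ(A) ⊗ ℂ`** (the Weil classes of `(A, k)`; Gordon 5.13 (ii), van Geemen 4.5/4.7, Pohlmann §3) — and at least two
  independent ones (`two_le_finrank_hodgeClassSpan_sub_finrank_divisorClassesSpan_of_cosetBalanced`);
* `cosetBalanced_of_isAutTransform` — coset-balance is a property of Shimura's FAMILY of `Φ` (transforms by `Aut(L)`).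

This is the form in which the degenerate primitive types of the cyclotomic fields of degree `12` — `ℚ(ζ₂₁)`, `ℚ(ζ₂₈)`, `ℚ(ζ₃₆)`,
two families of `12` in each, Dodson's «converse of Ribet's theorem» (Thm. 3.2.1: simple degenerate CM abelian varieties of
dimension `n = kl` and rank `n − l + 2`, here `6 = 3·2`, rank `6`) — are certified by `decide` in the sequel files (the tree's
`DegenerateCMTypeCyclotomic21` does the first of the six, `{1,2,4,5,8,10} ⊂ (ℤ/21)ˣ` over `ℚ(√−3)`, by hand).

§1 Galois bookkeeping for `ℚ(ζ_N)` (any two embeddings differ by an automorphism; the subgroup cut out by `W`; the fibres of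
`Hom(L, ℂ) → Hom(L^H, ℂ)` are the `H`-orbits; their trace on `Φ` counted on the coset `e(φ)W`; `L^H` has no real place when
`−1 ∉ W`); §2 the three theorems; §3 transport along families.

## References

* [Gordon1999HodgeAVSurvey] B. B. Gordon, *A survey of the Hodge conjecture for abelian varieties* (1999), 5.13 (ii), 9.2.2,
  9.4.3 Theorem [B.140] (Yanai).
* [Dodson1984] B. Dodson, *The structure of Galois groups of CM-fields*, Trans. AMS 283 (1984), §3.1.0 (rank, degenerate),
  Thm. 3.2.1 («A converse of Ribet's theorem», held text p0013).
* [vanGeemen1994HodgeAV] B. van Geemen, *An introduction to the Hodge conjecture for abelian varieties*, LNM 1594 (1994),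
  Thm. 4.5, 4.7, Def. 4.9.
* [Pohlmann1968] H. Pohlmann, *Algebraic cycles on abelian varieties of complex multiplication type*, Ann. of Math. 88 (1968), §3.
* [Shimura1998] G. Shimura, *Abelian Varieties with Complex Multiplication and Modular Functions* (1998), §8.2 Prop. 26, §8.4.
* [MilneFT2022] J. S. Milne, *Fields and Galois Theory* (2022), Thm. 3.16 (Galois correspondence), Prop. 2.7 (a).
* [Washington1997] L. C. Washington, *Introduction to Cyclotomic Fields*, Thm. 2.5 (`Gal(ℚ(ζ_N)/ℚ) ≅ (ℤ/N)ˣ`).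
-/

set_option autoImplicit false

noncomputable section

open CategoryTheory NumberField

namespace Literature.AlgebraicGeometry.Pohlmann1968

namespace Cyclotomic

open Literature.NumberTheory.ComplexMultiplication
open Literature.AlgebraicGeometry.Motives (AbelianVariety CMType)
open Literature.AlgebraicGeometry.HodgeTheory
open Literature.AlgebraicGeometry.ComplexMultiplication (IsCMTypeRealisation)
open Literature.AlgebraicGeometry.ComplexMultiplication.CyclotomicCMTypeResidueSets
open Literature.Barriers.HodgeConjecture (divisorClassesSpan)
open Literature.AlgebraicGeometry.VanGeemen1994 (hodgeClassSpan)

variable {N : ℕ} [NeZero N] {L : Type} [Field L] [NumberField L] [hL : IsCyclotomicExtension {N} ℚ L]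

/-! ## §1 Galois bookkeeping for `ℚ(ζ_N)` on residues -/

/-- A residue is a unit residue iff it is a unit of `ℤ/N` (the tree's `mem_unitResidues_iff_isUnit`, re-proved to keep the
imports light). [cite: Washington1997, Thm. 2.5] -/
private theorem mem_unitResidues_iff_isUnit₁ (c : ZMod N) : c ∈ unitResidues N ↔ IsUnit c := by
  rw [← coprime_iff_mem_unitResidues, ← ZMod.isUnit_iff_coprime, ZMod.natCast_zmod_val]

/-- A unit residue has an inverse among the unit residues. [cite: Washington1997, Thm. 2.5] -/
private theorem exists_mul_eq_one₀ {c : ZMod N} (hc : c ∈ unitResidues N) : ∃ d ∈ unitResidues N, c * d = 1 := by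
  rw [mem_unitResidues_iff_isUnit₁] at hc
  obtain ⟨u, rfl⟩ := hc
  exact ⟨((u⁻¹ : (ZMod N)ˣ) : ZMod N), (mem_unitResidues_iff_isUnit₁ _).2 (u⁻¹).isUnit, u.mul_inv⟩

/-- Products of unit residues are unit residues. [cite: Washington1997, Thm. 2.5] -/
private theorem mul_mem_unitResidues₀ {a b : ZMod N} (ha : a ∈ unitResidues N) (hb : b ∈ unitResidues N) :
    a * b ∈ unitResidues N := by
  rw [mem_unitResidues_iff_isUnit₁] at ha hb ⊢
  exact ha.mul hb

/-- The exponent of an embedding is a unit of `ℤ/N`. [cite: Washington1997, Thm. 2.5] -/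
private theorem isUnit_expOf (φ : L →+* ℂ) : IsUnit (expOf N L φ) :=
  (mem_unitResidues_iff_isUnit₁ _).1 ((coprime_iff_mem_unitResidues N _).1 (coprime_expOf N L φ))

/-- `γ ↦ a(γ)` is injective (Mathlib `IsPrimitiveRoot.autToPow_injective`; the tree's `autResidue_injective` of
`CyclotomicCMTypeIsogenyClasses`, re-proved to keep the imports light). [cite: Washington1997, Thm. 2.5] -/
private theorem autResidue_injective₀ : Function.Injective (autResidue N L) := fun _ _ h =>
  (IsCyclotomicExtension.zeta_spec N ℚ L).autToPow_injective ℚ (Units.ext h)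

/-- `a(1) = 1`. [cite: Washington1997, Thm. 2.5] -/
private theorem autResidue_one₀ : autResidue N L 1 = 1 := by
  simp [autResidue, map_one]

/-- `a(γᵏ) = a(γ)ᵏ`. [cite: Washington1997, Thm. 2.5] -/
private theorem autResidue_pow₀ (γ : L ≃ₐ[ℚ] L) (k : ℕ) : autResidue N L (γ ^ k) = autResidue N L γ ^ k := by
  induction k with
  | zero => rw [pow_zero, pow_zero, autResidue_one₀]
  | succ k ih => rw [pow_succ, autResidue_mul, ih, pow_succ]

include hL in
/-- **Any two complex embeddings of `ℚ(ζ_N)` differ by an automorphism**: `φ = φ₁ ∘ γ` with `a(γ) = e(φ) e(φ₁)⁻¹`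
(`ℚ(ζ_N)/ℚ` is Galois). [cite: Washington1997, Thm. 2.5] -/
theorem exists_eq_comp_algEquiv (φ φ₁ : L →+* ℂ) : ∃ γ : L ≃ₐ[ℚ] L, φ = φ₁.comp (γ : L →+* L) := by
  have hu := (coprime_iff_mem_unitResidues N _).1 (coprime_expOf N L φ)
  have hu₁ := (coprime_iff_mem_unitResidues N _).1 (coprime_expOf N L φ₁)
  obtain ⟨d, hd, hd1⟩ := exists_mul_eq_one₀ hu₁
  obtain ⟨γ, hγ⟩ := exists_autResidue_eq N (L := L) (expOf N L φ * d) (mul_mem_unitResidues₀ hu hd)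
  refine ⟨γ, expOf_injective N L ?_⟩
  rw [expOf_comp_algEquiv, hγ, mul_left_comm, hd1, mul_one]

/-- **The subgroup `H = {γ | a(γ) ∈ W}` of `Gal(ℚ(ζ_N)/ℚ)`** cut out by a multiplicatively closed `W ∋ 1` (inverses come for free in
the finite group: `γ⁻¹ = γ^{ord γ − 1}`). [cite: Washington1997, Thm. 2.5] -/
theorem exists_subgroup_mem_iff_autResidue_mem {W : Finset (ZMod N)} (h1 : (1 : ZMod N) ∈ W)
    (hmul : ∀ a ∈ W, ∀ b ∈ W, a * b ∈ W) :
    ∃ H : Subgroup (L ≃ₐ[ℚ] L), ∀ γ : L ≃ₐ[ℚ] L, γ ∈ H ↔ autResidue N L γ ∈ W := by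
  have hpow : ∀ γ : L ≃ₐ[ℚ] L, autResidue N L γ ∈ W → ∀ k : ℕ, autResidue N L (γ ^ k) ∈ W := by
    intro γ hγ k
    induction k with
    | zero => rw [pow_zero, autResidue_one₀]; exact h1
    | succ k ih => rw [pow_succ, autResidue_mul]; exact hmul _ ih _ hγ
  refine ⟨{ carrier := {γ | autResidue N L γ ∈ W}
            mul_mem' := fun {a b} ha hb => by
              show autResidue N L (a * b) ∈ W
              rw [autResidue_mul]; exact hmul _ ha _ hb
            one_mem' := by show autResidue N L 1 ∈ W; rw [autResidue_one₀]; exact h1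
            inv_mem' := fun {γ} hγ => by
              show autResidue N L γ⁻¹ ∈ W
              have hord := pow_orderOf_eq_one γ
              have hpos := orderOf_pos γ
              have hinv : γ⁻¹ = γ ^ (orderOf γ - 1) := by
                rw [eq_comm, ← mul_left_cancel_iff (a := γ), mul_inv_cancel, ← pow_succ', Nat.sub_add_cancel hpos, hord]
              rw [hinv]; exact hpow γ hγ _ }, fun γ => Iff.rfl⟩

section Fibres

variable {W : Finset (ZMod N)} {H : Subgroup (L ≃ₐ[ℚ] L)}

/-- Elements of `H` fix `L^H` pointwise: `φ ∘ γ` and `φ` agree on the fixed field. [cite: MilneFT2022, Thm. 3.16] -/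
theorem comp_algEquiv_comp_algebraMap_fixedField {γ : L ≃ₐ[ℚ] L} (hγ : γ ∈ H) (φ : L →+* ℂ) :
    (φ.comp (γ : L →+* L)).comp (algebraMap (IntermediateField.fixedField H) L) =
      φ.comp (algebraMap (IntermediateField.fixedField H) L) := by
  refine RingHom.ext fun x => ?_
  simp only [RingHom.comp_apply, IntermediateField.algebraMap_apply, RingHom.coe_coe]
  rw [(IntermediateField.mem_fixedField_iff H (x : L)).1 x.2 γ hγ]

omit hL in
/-- **The fibres of `Hom(L, ℂ) → Hom(L^H, ℂ)` are the `H`-orbits**: `φ'` and `φ` agree on the fixed field `L^H` iff `φ' = φ ∘ γ`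
for some `γ ∈ H` (Galois correspondence: the automorphisms fixing `L^H` pointwise are exactly `H`).
[cite: MilneFT2022, Thm. 3.16] [cite: Washington1997, Thm. 2.5] -/
theorem comp_algebraMap_fixedField_eq_iff (hL : IsCyclotomicExtension {N} ℚ L) (φ φ' : L →+* ℂ) :
    φ'.comp (algebraMap (IntermediateField.fixedField H) L) = φ.comp (algebraMap (IntermediateField.fixedField H) L) ↔
      ∃ γ ∈ H, φ' = φ.comp (γ : L →+* L) := by
  constructor
  · intro h
    obtain ⟨γ, rfl⟩ := exists_eq_comp_algEquiv (N := N) φ' φ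
    refine ⟨γ, ?_, rfl⟩
    rw [← IntermediateField.fixingSubgroup_fixedField H]
    refine (mem_fixingSubgroup_iff (L ≃ₐ[ℚ] L)).2 fun y hy => ?_
    rw [AlgEquiv.smul_def]
    apply φ.injective
    have := RingHom.congr_fun h ⟨y, hy⟩
    simpa only [RingHom.comp_apply, IntermediateField.algebraMap_apply, RingHom.coe_coe] using this
  · rintro ⟨γ, hγ, rfl⟩
    exact comp_algEquiv_comp_algebraMap_fixedField hγ φ

/-- **The trace of a fibre, counted on the coset `e(φ)·W`**: for `H = {γ | a(γ) ∈ W}` (`W ⊆ (ℤ/N)ˣ`), the embeddings agreeing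
with `φ` on `L^H` whose exponent satisfies `Q` are as many as the `w ∈ W` with `Q(e(φ) w)` (`e(φ ∘ γ) = e(φ) a(γ)`; embeddings
are determined by their exponents). [cite: Shimura1998, §8.4 Example (1)] [cite: Washington1997, Thm. 2.5] -/
theorem ncard_setOf_comp_algebraMap_fixedField_eq (hH : ∀ γ : L ≃ₐ[ℚ] L, γ ∈ H ↔ autResidue N L γ ∈ W)
    (hWu : W ⊆ unitResidues N) (φ : L →+* ℂ) (Q : ZMod N → Prop) [DecidablePred Q] :
    {φ' : L →+* ℂ | φ'.comp (algebraMap (IntermediateField.fixedField H) L) =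
        φ.comp (algebraMap (IntermediateField.fixedField H) L) ∧ Q (expOf N L φ')}.ncard =
      (W.filter fun w => Q (expOf N L φ * w)).card := by
  classical
  have hu : IsUnit (expOf N L φ) := isUnit_expOf φ
  set T := {φ' : L →+* ℂ | φ'.comp (algebraMap (IntermediateField.fixedField H) L) =
      φ.comp (algebraMap (IntermediateField.fixedField H) L) ∧ Q (expOf N L φ')}
  have himage : expOf N L '' T = ↑((W.filter fun w => Q (expOf N L φ * w)).image fun w => expOf N L φ * w) := by
    ext c
    simp only [Set.mem_image, Set.mem_setOf_eq, Finset.coe_image, Finset.coe_filter, T]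
    constructor
    · rintro ⟨φ', ⟨hφ', hQ⟩, rfl⟩
      obtain ⟨γ, hγ, rfl⟩ := (comp_algebraMap_fixedField_eq_iff hL φ φ').1 hφ'
      refine ⟨autResidue N L γ, ⟨(hH γ).1 hγ, ?_⟩, ?_⟩
      · rwa [expOf_comp_algEquiv] at hQ
      · rw [expOf_comp_algEquiv]
    · rintro ⟨w, ⟨hw, hQ⟩, rfl⟩
      obtain ⟨γ, hγ⟩ := exists_autResidue_eq N (L := L) w (hWu hw)
      refine ⟨φ.comp (γ : L →+* L), ⟨?_, ?_⟩, ?_⟩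
      · exact comp_algEquiv_comp_algebraMap_fixedField ((hH γ).2 (hγ ▸ hw)) φ
      · rw [expOf_comp_algEquiv, hγ]; exact hQ
      · rw [expOf_comp_algEquiv, hγ]
  rw [← Set.ncard_image_of_injective T (expOf_injective N L), himage, Set.ncard_coe_finset,
    Finset.card_image_of_injective _ (fun a b h => hu.mul_left_cancel h)]

/-- Every embedding of the subfield extends to `L` (`ℂ` algebraically closed, `L` algebraic). [cite: MilneFT2022, Prop. 2.7 (a)] -/
private theorem exists_comp_algebraMap_eq (τ : (IntermediateField.fixedField H) →+* ℂ) :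
    ∃ φ : L →+* ℂ, φ.comp (algebraMap (IntermediateField.fixedField H) L) = τ := by
  letI : Algebra (IntermediateField.fixedField H) ℂ := τ.toAlgebra
  haveI : Module.IsTorsionFree (IntermediateField.fixedField H) ℂ := DivisionSemiring.to_moduleIsTorsionFree
  haveI : Module.IsTorsionFree (IntermediateField.fixedField H) L := DivisionSemiring.to_moduleIsTorsionFree
  haveI : Algebra.IsAlgebraic (IntermediateField.fixedField H) L := Algebra.IsAlgebraic.tower_top (K := ℚ) _
  let ψ : L →ₐ[IntermediateField.fixedField H] ℂ := IsAlgClosed.lift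
  exact ⟨ψ.toRingHom, ψ.comp_algebraMap⟩

/-- **COSET-BALANCED ⟹ BALANCED OVER THE FIXED FIELD** (the hypothesis `hW` of `WeilTypeCMSubfieldExceptionalClasses`): if the
residue set of `Φ` meets every coset `cW` of `W` in as many points as it misses, then over every embedding of `k = L^H` as many
extensions lie in `Φ` as outside. [cite: Gordon1999HodgeAVSurvey, 9.4.3 (Theorem [B.140])] [cite: vanGeemen1994HodgeAV, 4.7 and Def. 4.9] -/
theorem fibres_balanced_of_cosetBalanced (hH : ∀ γ : L ≃ₐ[ℚ] L, γ ∈ H ↔ autResidue N L γ ∈ W) (hWu : W ⊆ unitResidues N)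
    (Φ : CMType L)
    (hbal : ∀ c ∈ unitResidues N, (W.filter fun w => c * w ∈ residueSet N Φ).card =
      (W.filter fun w => c * w ∉ residueSet N Φ).card)
    (τ : (IntermediateField.fixedField H) →+* ℂ) :
    {φ : L →+* ℂ | φ.comp (algebraMap (IntermediateField.fixedField H) L) = τ ∧ φ ∈ Φ.1}.ncard =
      {φ : L →+* ℂ | φ.comp (algebraMap (IntermediateField.fixedField H) L) = τ ∧ φ ∉ Φ.1}.ncard := by
  classical
  obtain ⟨φ, rfl⟩ := exists_comp_algebraMap_eq (H := H) τ
  have h1 := ncard_setOf_comp_algebraMap_fixedField_eq hH hWu φ (fun c => c ∈ residueSet N Φ)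
  have h2 := ncard_setOf_comp_algebraMap_fixedField_eq hH hWu φ (fun c => c ∉ residueSet N Φ)
  simp only [expOf_mem_residueSet_iff] at h1 h2
  rw [h1, h2]
  exact hbal _ ((coprime_iff_mem_unitResidues N _).1 (coprime_expOf N L φ))

open scoped Classical in
/-- Each fibre has `|W|` elements (`= |H| = [L : L^H]`). [cite: MilneFT2022, Prop. 2.7 (a)] -/
theorem card_filter_comp_algebraMap_fixedField_eq (hH : ∀ γ : L ≃ₐ[ℚ] L, γ ∈ H ↔ autResidue N L γ ∈ W)
    (hWu : W ⊆ unitResidues N) (τ : (IntermediateField.fixedField H) →+* ℂ) :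
    (Finset.univ.filter fun φ : L →+* ℂ => φ.comp (algebraMap (IntermediateField.fixedField H) L) = τ).card = W.card := by
  classical
  obtain ⟨φ, rfl⟩ := exists_comp_algebraMap_eq (H := H) τ
  have h := ncard_setOf_comp_algebraMap_fixedField_eq hH hWu φ (fun _ => True)
  simp only [and_true, Finset.filter_true_of_mem (fun _ _ => trivial)] at h
  rw [← h, ← Set.ncard_coe_finset]
  congr 1
  ext φ'
  simp only [Finset.coe_filter, Finset.mem_univ, true_and, Set.mem_setOf_eq]

/-- **`L^H` has no real place when `−1 ∉ W`**: the restriction `τ₀ = φ|_{L^H}` of any embedding is not self-conjugate (else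
`φ̄ = φ ∘ γ` with `γ ∈ H`, i.e. `−e(φ) = e(φ) a(γ)`, `a(γ) = −1 ∈ W`). [cite: Shimura1998, §8.4 Example (1)] -/
theorem conjugate_comp_algebraMap_fixedField_ne (hH : ∀ γ : L ≃ₐ[ℚ] L, γ ∈ H ↔ autResidue N L γ ∈ W)
    (hneg : (-1 : ZMod N) ∉ W) (φ : L →+* ℂ) :
    ComplexEmbedding.conjugate (φ.comp (algebraMap (IntermediateField.fixedField H) L)) ≠
      φ.comp (algebraMap (IntermediateField.fixedField H) L) := by
  intro h
  have h' : (ComplexEmbedding.conjugate φ).comp (algebraMap (IntermediateField.fixedField H) L) =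
      φ.comp (algebraMap (IntermediateField.fixedField H) L) := by
    rw [← h]; rfl
  obtain ⟨γ, hγ, hc⟩ := (comp_algebraMap_fixedField_eq_iff hL φ _).1 h'
  have he := congrArg (expOf N L) hc
  rw [expOf_conjugate, expOf_comp_algEquiv] at he
  have hu : IsUnit (expOf N L φ) := isUnit_expOf φ
  have : autResidue N L γ = -1 := hu.mul_left_cancel (by rw [← he, mul_neg_one])
  exact hneg (this ▸ (hH γ).1 hγ)

end Fibres

/-! ## §2 Coset-balanced types: degenerate (Yanai), rank `≤ n`, exceptional classes on every realisation of a primitive one -/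

section Main

variable (Φ : CMType L) {W : Finset (ZMod N)}

/-- `−1 ≠ 1` among the residues forces `N > 2`. [folklore] -/
private theorem two_lt_of_neg_one_ne (h : (-1 : ZMod N) ≠ 1) : 2 < N := by
  by_contra hN
  have hN' : N ≤ 2 := not_lt.1 hN
  have hN0 := NeZero.ne N
  interval_cases N
  · exact hN0 rfl
  · exact h (Subsingleton.elim _ _)
  · exact h (by decide)

omit [NeZero N] in
/-- `ℚ(ζ_N)` is a CM field for `N > 2` (Mathlib). [folklore] -/
private theorem isCMField₀ (hN : 2 < N) : IsCMField L :=
  IsCyclotomicExtension.Rat.isCMField L (S := ({N} : Set ℕ)) ⟨N, rfl, hN⟩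

/-- **YANAI'S THEOREM ON RESIDUES: A COSET-BALANCED CM TYPE OF `ℚ(ζ_N)` IS DEGENERATE.**  If `W ⊆ (ℤ/N)ˣ` is multiplicatively
closed with `1 ∈ W`, `−1 ∉ W`, and the residue set `S` of `Φ` satisfies `#{w ∈ W | cw ∈ S} = #{w ∈ W | cw ∉ S}` for every unit `c`,
then `Φ` is balanced over the CM subfield `L^{a⁻¹(W)}` (of degree `φ(N)/|W|`), hence `Rank(Φ) < n + 1`.
[cite: Gordon1999HodgeAVSurvey, 9.4.3 (Theorem [B.140], Yanai 1994)] [cite: Dodson1984, §3.1.0 and Thm. 3.2.1] -/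
theorem not_isNondegenerate_of_cosetBalanced (hWu : W ⊆ unitResidues N) (h1 : (1 : ZMod N) ∈ W)
    (hmul : ∀ a ∈ W, ∀ b ∈ W, a * b ∈ W) (hneg : (-1 : ZMod N) ∉ W)
    (hbal : ∀ c ∈ unitResidues N, (W.filter fun w => c * w ∈ residueSet N Φ).card =
      (W.filter fun w => c * w ∉ residueSet N Φ).card) :
    ¬IsNondegenerate Φ := by
  haveI := isCMField₀ (L := L) (two_lt_of_neg_one_ne fun h => hneg (by rw [h]; exact h1))
  obtain ⟨H, hH⟩ := exists_subgroup_mem_iff_autResidue_mem (L := L) h1 hmul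
  obtain ⟨φ⟩ : Nonempty (L →+* ℂ) := inferInstance
  exact not_isNondegenerate_of_fibres_balanced (algebraMap (IntermediateField.fixedField H) L)
    (fibres_balanced_of_cosetBalanced hH hWu Φ hbal) (conjugate_comp_algebraMap_fixedField_ne hH hneg φ)

/-- **`Rank(Φ) ≤ n = φ(N)/2` for a coset-balanced type** (Yanai's bound `rank + |T| ≤ n + 1` with `T` one non-real place of `L^H`;
the index of degeneracy is at least `1`).  For the degenerate primitive types of `ℚ(ζ₂₁)`, `ℚ(ζ₂₈)`, `ℚ(ζ₃₆)` this is Dodson's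
`rank = n − l + 2 = 6` with `(k, l) = (3, 2)`, an equality (sequel files).
[cite: Gordon1999HodgeAVSurvey, 9.4.3 (Theorem [B.140], Yanai 1994)] [cite: Dodson1984, Thm. 3.2.1] -/
theorem cmTypeRank_le_of_cosetBalanced (hWu : W ⊆ unitResidues N) (h1 : (1 : ZMod N) ∈ W)
    (hmul : ∀ a ∈ W, ∀ b ∈ W, a * b ∈ W) (hneg : (-1 : ZMod N) ∉ W)
    (hbal : ∀ c ∈ unitResidues N, (W.filter fun w => c * w ∈ residueSet N Φ).card =
      (W.filter fun w => c * w ∉ residueSet N Φ).card) :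
    cmTypeRank Φ ≤ N.totient / 2 := by
  haveI := isCMField₀ (L := L) (two_lt_of_neg_one_ne fun h => hneg (by rw [h]; exact h1))
  obtain ⟨H, hH⟩ := exists_subgroup_mem_iff_autResidue_mem (L := L) h1 hmul
  obtain ⟨φ⟩ : Nonempty (L →+* ℂ) := inferInstance
  have h := cmTypeRank_add_card_le_of_fibres_balanced (algebraMap (IntermediateField.fixedField H) L)
    (fibres_balanced_of_cosetBalanced hH hWu Φ hbal) {φ.comp (algebraMap (IntermediateField.fixedField H) L)}
    (fun τ hτ τ' hτ' => by
      rw [Finset.mem_singleton] at hτ hτ'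
      rw [hτ, hτ']
      exact conjugate_comp_algebraMap_fixedField_ne hH hneg φ)
  rw [Finset.card_singleton, finrank_eq_totient N L] at h
  omega

/-- **Yanai's bound at full strength on residues: `Rank(Φ) + [L^H : ℚ]/2 ≤ φ(N)/2 + 1`, `[L^H : ℚ]·|W| = φ(N)`** — the index of
degeneracy `φ(N)/2 + 1 − Rank(Φ)` of a type coset-balanced for `W` is at least half the degree of the fixed field `L^H` (`a(H) = W`):
`L^H` is totally complex (no embedding of `L^H` is self-conjugate, as `−1 ∉ W`), so it carries a CM type `Ψ`, and Yanai's theorem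
(`cmTypeRank_add_finrank_div_two_le_of_fibres_balanced`, `T = Ψ`) applies; `[L : L^H] = |W|` (`card_fibre_eq_finrank`).  For
`|W| = φ(N)/2` this is `cmTypeRank_le_of_cosetBalanced`; for `ℚ(ζ₃₂)` and `W = {1, 7, 17, 23}` it reads `Rank ≤ 7`.
[cite: Gordon1999HodgeAVSurvey, 9.4.3 (Theorem [B.140], Yanai 1994: «if `a = b` then `d + 1 − rank S ≥ d₁`»)] [cite: MilneFT2022, Prop. 2.7 (a)] -/
theorem cmTypeRank_add_le_of_cosetBalanced (hWu : W ⊆ unitResidues N) (h1 : (1 : ZMod N) ∈ W)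
    (hmul : ∀ a ∈ W, ∀ b ∈ W, a * b ∈ W) (hneg : (-1 : ZMod N) ∉ W)
    (hbal : ∀ c ∈ unitResidues N, (W.filter fun w => c * w ∈ residueSet N Φ).card =
      (W.filter fun w => c * w ∉ residueSet N Φ).card) {m : ℕ} (hm : W.card * (2 * m) = N.totient) :
    cmTypeRank Φ + m ≤ N.totient / 2 + 1 := by
  haveI := isCMField₀ (L := L) (two_lt_of_neg_one_ne fun h => hneg (by rw [h]; exact h1))
  obtain ⟨H, hH⟩ := exists_subgroup_mem_iff_autResidue_mem (L := L) h1 hmul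
  haveI : IsTotallyComplex (IntermediateField.fixedField H) := by
    refine ⟨fun v => ?_⟩
    rw [← InfinitePlace.not_isReal_iff_isComplex, InfinitePlace.isReal_iff, ComplexEmbedding.isReal_iff]
    obtain ⟨φ, hφ⟩ := exists_comp_algebraMap_eq (H := H) v.embedding
    rw [← hφ]
    exact conjugate_comp_algebraMap_fixedField_ne hH hneg φ
  obtain ⟨Ψ⟩ := (CMTypeCount.nonempty_cmType_iff_isTotallyComplex (K := ↥(IntermediateField.fixedField H))).2 inferInstance
  have h := cmTypeRank_add_finrank_div_two_le_of_fibres_balanced (algebraMap (IntermediateField.fixedField H) L)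
    (fibres_balanced_of_cosetBalanced hH hWu Φ hbal) Ψ
  obtain ⟨φ⟩ : Nonempty (L →+* ℂ) := inferInstance
  have hdeg : Module.finrank (IntermediateField.fixedField H) L = W.card := by
    rw [← card_fibre_eq_finrank (φ.comp (algebraMap (IntermediateField.fixedField H) L)),
      card_filter_comp_algebraMap_fixedField_eq hH hWu]
  have htower := Module.finrank_mul_finrank ℚ (IntermediateField.fixedField H) L
  rw [hdeg, finrank_eq_totient N L, ← hm, mul_comm] at htower
  have hpos : 0 < W.card := Finset.card_pos.2 ⟨1, h1⟩
  have hk : Module.finrank ℚ (IntermediateField.fixedField H) = 2 * m := Nat.eq_of_mul_eq_mul_left hpos htower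
  rw [hk, finrank_eq_totient N L] at h
  omega

variable {Φ} {A : AbelianVariety ℂ} {ι : 𝓞 L →+* End A} {θ : L →+* Module.End ℂ (complexBetti A.X 1)}

/-- **THE MUMFORD–POHLMANN MECHANISM ON RESIDUES: every realisation of a PRIMITIVE coset-balanced CM type of `ℚ(ζ_N)` carries a
rational Hodge class of type `(m, m)`, `2m = |W|`, outside `Dᵐ(A) ⊗ ℂ`** — the Weil classes of `(A, L^H)`, `[L : L^H] = |W|`; `A` is
simple (Shimura §8.2 Prop. 26) of dimension `φ(N)/2`.  For `ℚ(ζ₂₁)`, `ℚ(ζ₂₈)`, `ℚ(ζ₃₆)` and `|W| = 6`: simple CM SIXFOLDS with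
`B³ ≠ D³` (Dodson's degenerate varieties of rank `6`).
[cite: Gordon1999HodgeAVSurvey, 5.13 (ii) and 9.2.2] [cite: vanGeemen1994HodgeAV, Thm. 4.5 and 4.7] [cite: Pohlmann1968, §3]
[cite: Dodson1984, Thm. 3.2.1] -/
theorem exists_exceptional_of_cosetBalanced (hWu : W ⊆ unitResidues N) (h1 : (1 : ZMod N) ∈ W)
    (hmul : ∀ a ∈ W, ∀ b ∈ W, a * b ∈ W) (hneg : (-1 : ZMod N) ∉ W)
    (hbal : ∀ c ∈ unitResidues N, (W.filter fun w => c * w ∈ residueSet N Φ).card =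
      (W.filter fun w => c * w ∉ residueSet N Φ).card)
    (hprim : HasTrivialStabilizer N (residueSet N Φ)) {m : ℕ} (hm : W.card = 2 * m) (hA : IsCMTypeRealisation Φ A ι θ) :
    ∃ c : complexBetti A.X (2 * m), IsRationalClass c ∧ IsOfHodgeType (N.totient / 2) A.X (2 * m) m m c ∧
      c ∉ divisorClassesSpan A.X (N.totient / 2) m := by
  haveI := isCMField₀ (L := L) (two_lt_of_neg_one_ne fun h => hneg (by rw [h]; exact h1))
  obtain ⟨H, hH⟩ := exists_subgroup_mem_iff_autResidue_mem (L := L) h1 hmul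
  obtain ⟨φ⟩ : Nonempty (L →+* ℂ) := inferInstance
  have hprim' : IsPrimitive (ℂ ≃+* ℂ) Φ.1 φ := (isPrimitive_iff_hasTrivialStabilizer N Φ φ).2 hprim
  obtain ⟨m', hm', c, hcQ, hcH, hcD⟩ := exists_exceptional_of_fibres_balanced'
    (algebraMap (IntermediateField.fixedField H) L) φ hprim' (fibres_balanced_of_cosetBalanced hH hWu Φ hbal)
    (conjugate_comp_algebraMap_fixedField_ne hH hneg φ) hA
  rw [card_filter_comp_algebraMap_fixedField_eq hH hWu, hm] at hm'
  obtain rfl : m' = m := by omega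
  rw [finrank_eq_totient N L] at hcH hcD
  exact ⟨c, hcQ, hcH, hcD⟩

/-- **At least two independent exceptional lines in degree `2m = |W|`**: `dim Bᵐ(A) − dim Dᵐ(A) ≥ 2` for every realisation of a
primitive coset-balanced type (the fibre over `τ₀` and its conjugate; Gordon 5.13 (ii): `= 2` for Weil-type CM fourfolds).
[cite: Gordon1999HodgeAVSurvey, 5.13 (ii) and 9.2.2] -/
theorem two_le_finrank_hodgeClassSpan_sub_finrank_divisorClassesSpan_of_cosetBalanced (hWu : W ⊆ unitResidues N)
    (h1 : (1 : ZMod N) ∈ W) (hmul : ∀ a ∈ W, ∀ b ∈ W, a * b ∈ W) (hneg : (-1 : ZMod N) ∉ W)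
    (hbal : ∀ c ∈ unitResidues N, (W.filter fun w => c * w ∈ residueSet N Φ).card =
      (W.filter fun w => c * w ∉ residueSet N Φ).card)
    (hprim : HasTrivialStabilizer N (residueSet N Φ)) {m : ℕ} (hm : W.card = 2 * m) (hA : IsCMTypeRealisation Φ A ι θ) :
    2 ≤ Module.finrank ℂ ↥(hodgeClassSpan (N.totient / 2) A.X m) - Module.finrank ℂ ↥(divisorClassesSpan A.X (N.totient / 2) m) := by
  classical
  haveI := isCMField₀ (L := L) (two_lt_of_neg_one_ne fun h => hneg (by rw [h]; exact h1))
  obtain ⟨H, hH⟩ := exists_subgroup_mem_iff_autResidue_mem (L := L) h1 hmul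
  obtain ⟨φ⟩ : Nonempty (L →+* ℂ) := inferInstance
  have hprim' : IsPrimitive (ℂ ≃+* ℂ) Φ.1 φ := (isPrimitive_iff_hasTrivialStabilizer N Φ φ).2 hprim
  have h := two_le_finrank_hodgeClassSpan_sub_finrank_divisorClassesSpan (algebraMap (IntermediateField.fixedField H) L) φ
    hprim' (fibres_balanced_of_cosetBalanced hH hWu Φ hbal) (conjugate_comp_algebraMap_fixedField_ne hH hneg φ) hA
  have hdeg : {φ' : L →+* ℂ | φ'.comp (algebraMap (IntermediateField.fixedField H) L) =
      φ.comp (algebraMap (IntermediateField.fixedField H) L) ∧ φ' ∈ Φ.1}.ncard = m := by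
    have h1' := ncard_setOf_comp_algebraMap_fixedField_eq hH hWu φ (fun c => c ∈ residueSet N Φ)
    simp only [expOf_mem_residueSet_iff] at h1'
    rw [h1']
    have hc := hbal _ ((coprime_iff_mem_unitResidues N _).1 (coprime_expOf N L φ))
    have hsum := Finset.card_filter_add_card_filter_not (s := W) (fun w => expOf N L φ * w ∈ residueSet N Φ)
    omega
  rwa [hdeg, finrank_eq_totient N L] at h

end Main

/-! ## §3 Coset-balance along Shimura's families -/

/-- **Coset-balance is a property of the FAMILY**: if `Ψ` is the transform of `Φ` by an automorphism of `ℚ(ζ_N)` (`S_Ψ = S_Φ·d⁻¹`),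
then `S_Ψ` is coset-balanced for `W` as soon as `S_Φ` is (the cosets are permuted: `c ↦ cd`). [cite: Shimura1998, §8.4 Example (1)] -/
theorem cosetBalanced_of_isAutTransform {Φ Ψ : CMType L} (h : IsAutTransform Φ Ψ) {W : Finset (ZMod N)}
    (hWu : W ⊆ unitResidues N)
    (hbal : ∀ c ∈ unitResidues N, (W.filter fun w => c * w ∈ residueSet N Φ).card =
      (W.filter fun w => c * w ∉ residueSet N Φ).card) :
    ∀ c ∈ unitResidues N, (W.filter fun w => c * w ∈ residueSet N Ψ).card =
      (W.filter fun w => c * w ∉ residueSet N Ψ).card := by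
  classical
  obtain ⟨d, hd, hΨ⟩ := (isAutTransform_iff N Φ Ψ).1 h
  intro c hc
  have key : ∀ w ∈ W, (c * w ∈ residueSet N Ψ ↔ c * d * w ∈ residueSet N Φ) := fun w hw => by
    rw [hΨ _ (mul_mem_unitResidues₀ hc (hWu hw)), mul_right_comm]
  rw [Finset.filter_congr (fun w hw => key w hw), Finset.filter_congr (fun w hw => not_congr (key w hw))]
  exact hbal _ (mul_mem_unitResidues₀ hc hd)

end Cyclotomic

end Literature.AlgebraicGeometry.Pohlmann1968

end
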